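import Literature.Probability.Percolation.ZdAnnulusBlockedGeneral
import Mathlib.Analysis.SpecialFunctions.Pow.Real
import HarnessLib

/-!
# The one-arm a priori bound in power form, bond percolation on `ℤ²` at a general parameter

Topic `Literature/Probability/Percolation`; proofs only (no definition, no named fact). Sequel of
`ZdAnnulusBlockedGeneral.lean` in the bottom-up layers towards `Kesten1987_zdKestenRelation`
(`ZdNearCriticalWindow.lean`): the geometric decay `P_p(B(r) ↔ B(R)ᶜ) ≤ (1 - c)^K` in the number
`K` of free annuli (`real_boxToFar_le_pow`, `3 r 4^K ≤ R + 1`) is repackaged in the usual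
power-law form of Nolin 2008, Prop. 14 (`j = 1`, upper bound) [arXiv 0711.4948: Prop. 13]:
"there exist some exponents `0 < α_j, α' < ∞` and constants `0 < C_j, C' < ∞` such that
`… P̂(𝒜_{j,σ}(n, N)) ≤ C' (n/N)^{α'}`", uniformly in `p` (here `p ≤ 1/2` at every scale, and
`p > 1/2` for `R < L_ε(p)`):

* `ZdOneArm.pow_le_rpow_of_scales` — the arithmetic: with `K = ⌊log₄((R+1)/(3r))⌋`,
  `3 r 4^K ≤ R + 1`, `R < 12 r 4^K`, and `(1-c)^K ≤ 12^{α} (r/R)^{α}` for `α = c / log 4`;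
* `exists_real_boxToFar_le_rpow_of_le_half` — **`P_p(B(r) ↔ B(R)ᶜ) ≤ C (r/R)^α` for all
  `p ≤ 1/2`, `1 ≤ r ≤ R`**;
* `exists_real_boxToFar_le_rpow_of_half_lt` — the same for `p > 1/2` and `R < L_ε(p)`, with
  constants depending on `ε` only.
-/

noncomputable section

open MeasureTheory Set
open scoped unitInterval

namespace Literature.Probability.Percolation

open LatticeModels

/-- **From geometric decay in the number of annuli to a power law.** For `0 < c ≤ 1` and
`1 ≤ r ≤ R` with `3r ≤ R + 1`, the number `K = ⌊log₄((R+1)/(3r))⌋` of annuli satisfies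
`3 r 4^K ≤ R + 1` and `(1 - c)^K ≤ 12^α (r/R)^α` with `α = c / log 4` (since `1 - c ≤ e^{-c}`
and `4^K > R/(12 r)`). [folklore] -/
theorem ZdOneArm.pow_le_rpow_of_scales {c : ℝ} (hc : 0 < c) (hc1 : c ≤ 1) {r R : ℕ} (hr : 1 ≤ r)
    (hrR : r ≤ R) (h3 : 3 * r ≤ R + 1) :
    ∃ K : ℕ, 3 * (r * 4 ^ K) ≤ R + 1 ∧
      (1 - c) ^ K ≤ (12 : ℝ) ^ (c / Real.log 4) * ((r : ℝ) / R) ^ (c / Real.log 4) := by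
  set q : ℕ := (R + 1) / (3 * r) with hq
  set K : ℕ := Nat.log 4 q with hK
  set α : ℝ := c / Real.log 4 with hα
  have hq1 : 1 ≤ q := (Nat.le_div_iff_mul_le (by omega)).2 (by simpa using h3)
  have hKq : 4 ^ K ≤ q := Nat.pow_log_le_self 4 (by omega)
  have hqK : q < 4 ^ (K + 1) := Nat.lt_pow_succ_log_self (by norm_num) q
  have ha : 3 * (r * 4 ^ K) ≤ R + 1 := by
    have h1 : 3 * r * q ≤ R + 1 := by
      have := Nat.div_mul_le_self (R + 1) (3 * r)
      rw [← hq] at this; linarith [Nat.mul_comm q (3 * r)]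
    calc 3 * (r * 4 ^ K) = 3 * r * 4 ^ K := by ring
      _ ≤ 3 * r * q := Nat.mul_le_mul_left _ hKq
      _ ≤ R + 1 := h1
  have hb : (R : ℝ) < 12 * r * 4 ^ K := by
    have h1 : R + 1 < 4 ^ (K + 1) * (3 * r) := (Nat.div_lt_iff_lt_mul (by omega)).1 hqK
    have h2 : (R : ℝ) + 1 < 4 ^ (K + 1) * (3 * r) := by exact_mod_cast h1
    have h3' : (4 : ℝ) ^ (K + 1) * (3 * r) = 12 * r * 4 ^ K := by rw [pow_succ]; ring
    linarith
  refine ⟨K, ha, ?_⟩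
  -- real-analysis part
  have hlog4 : 0 < Real.log 4 := Real.log_pos (by norm_num)
  have hα0 : 0 < α := div_pos hc hlog4
  have hθ0 : 0 ≤ 1 - c := by linarith
  have hr0 : (0 : ℝ) < r := by exact_mod_cast hr
  have hR0 : (0 : ℝ) < R := by exact_mod_cast (hr.trans hrR)
  have h4K : (0 : ℝ) < (4 : ℝ) ^ K := by positivity
  -- `(1 - c)^K ≤ e^{-cK} = (4^K)^{-α}`
  have h1 : (1 - c) ^ K ≤ Real.exp (-c) ^ K :=
    pow_le_pow_left₀ hθ0 (by linarith [Real.add_one_le_exp (-c)]) K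
  have h2 : Real.exp (-c) ^ K = ((4 : ℝ) ^ K) ^ (-α) := by
    rw [← Real.exp_nat_mul, Real.rpow_def_of_pos h4K, Real.log_pow]
    congr 1
    rw [hα]; field_simp
  -- `(4^K)^{-α} ≤ (R/(12 r))^{-α} = 12^α (r/R)^α`
  have hx : (0 : ℝ) < (R : ℝ) / (12 * r) := by positivity
  have hxy : (R : ℝ) / (12 * r) ≤ (4 : ℝ) ^ K := by
    rw [div_le_iff₀ (by positivity)]; linarith
  have h3r : ((4 : ℝ) ^ K) ^ (-α) ≤ ((R : ℝ) / (12 * r)) ^ (-α) :=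
    Real.rpow_le_rpow_of_nonpos hx hxy (by linarith)
  have h4 : ((R : ℝ) / (12 * r)) ^ (-α) = (12 : ℝ) ^ α * ((r : ℝ) / R) ^ α := by
    rw [Real.rpow_neg hx.le, ← Real.inv_rpow hx.le, inv_div,
      show (12 : ℝ) * r / R = 12 * ((r : ℝ) / R) by ring,
      Real.mul_rpow (by norm_num) (by positivity)]
  calc (1 - c) ^ K ≤ Real.exp (-c) ^ K := h1
    _ = ((4 : ℝ) ^ K) ^ (-α) := h2
    _ ≤ ((R : ℝ) / (12 * r)) ^ (-α) := h3r
    _ = (12 : ℝ) ^ α * ((r : ℝ) / R) ^ α := h4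

/-- When `3r > R + 1` the power bound is trivial: `1 ≤ 12^α (r/R)^α` (`α ≥ 0`, `r/R > 1/3`).
[folklore] -/
theorem ZdOneArm.one_le_rpow_of_close {α : ℝ} (hα : 0 ≤ α) {r R : ℕ} (hr : 1 ≤ r) (hrR : r ≤ R)
    (h3 : R + 1 < 3 * r) : (1 : ℝ) ≤ (12 : ℝ) ^ α * ((r : ℝ) / R) ^ α := by
  have hR0 : (0 : ℝ) < R := by exact_mod_cast (hr.trans hrR)
  have hthird : (1 : ℝ) / 3 ≤ (r : ℝ) / R := by
    rw [div_le_div_iff₀ (by norm_num) hR0]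
    have : (R : ℝ) + 1 < 3 * r := by exact_mod_cast h3
    linarith
  calc (1 : ℝ) ≤ (4 : ℝ) ^ α := Real.one_le_rpow (by norm_num) hα
    _ = (12 : ℝ) ^ α * ((1 : ℝ) / 3) ^ α := by
        rw [← Real.mul_rpow (by norm_num) (by norm_num)]; norm_num
    _ ≤ (12 : ℝ) ^ α * ((r : ℝ) / R) ^ α :=
        mul_le_mul_of_nonneg_left (Real.rpow_le_rpow (by norm_num) hthird hα) (by positivity)

/-- **A priori one-arm bound in power form, `p ≤ 1/2`, every scale** (Nolin 2008, Prop. 14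
(`j = 1`, upper bound) [arXiv 0711.4948: Prop. 13], "obtained by using concentric annuli", at a
sub-critical or critical parameter of bond percolation on `ℤ²`): there are `C, α > 0` with
`P_p(some site of B(r) is joined to some site outside B(R)) ≤ C (r/R)^α` for all `p ≤ 1/2` and
`1 ≤ r ≤ R`. [cite: Nolin2008, §4.2, Prop. 14 (arXiv 0711.4948: Prop. 13)] -/
theorem exists_real_boxToFar_le_rpow_of_le_half :
    ∃ C α : ℝ, 0 < C ∧ 0 < α ∧ ∀ p : unitInterval, (p : ℝ) ≤ 1 / 2 → ∀ r R : ℕ, 1 ≤ r → r ≤ R →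
      (bondPercolation (zdGraph 2) p).real
          {ω | ∃ x ∈ box 2 r, ∃ y ∉ box 2 R, ω ∈ openConnIn Set.univ x y} ≤
        C * ((r : ℝ) / R) ^ α := by
  obtain ⟨c, hc, h⟩ := exists_real_boxToFar_le_pow_of_le_half
  have hc1 : c ≤ 1 := by
    have h' := h half (by rw [coe_half]) 1 11 1 le_rfl (by norm_num)
    have : (0 : ℝ) ≤ (1 - c) ^ 1 := le_trans measureReal_nonneg h'
    rw [pow_one] at this; linarith
  have hlog4 : 0 < Real.log 4 := Real.log_pos (by norm_num)
  refine ⟨(12 : ℝ) ^ (c / Real.log 4), c / Real.log 4, by positivity, div_pos hc hlog4,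
    fun p hp r R hr hrR => ?_⟩
  by_cases h3 : 3 * r ≤ R + 1
  · obtain ⟨K, hK, hpow⟩ := ZdOneArm.pow_le_rpow_of_scales hc hc1 hr hrR h3
    exact (h p hp r R K hr hK).trans hpow
  · push Not at h3
    exact measureReal_le_one.trans (ZdOneArm.one_le_rpow_of_close (div_pos hc hlog4).le hr hrR h3)

/-- **A priori one-arm bound in power form, `p > 1/2` below `L_ε(p)`** (Nolin 2008, Prop. 14
(`j = 1`, upper bound) [arXiv 0711.4948: Prop. 13], uniformly for the scales below the
characteristic length): for `ε ∈ (0, 1/2)` there are `C, α > 0` (depending on `ε` only) with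
`P_p(B(r) ↔ B(R)ᶜ) ≤ C (r/R)^α` for all `p > 1/2` and `1 ≤ r ≤ R < L_ε(p)`.
[cite: Nolin2008, §4.2, Prop. 14 (arXiv 0711.4948: Prop. 13)] -/
theorem exists_real_boxToFar_le_rpow_of_half_lt {ε : ℝ} (hε : 0 < ε) (hε' : ε < 1 / 2) :
    ∃ C α : ℝ, 0 < C ∧ 0 < α ∧ ∀ p : unitInterval, 1 / 2 < (p : ℝ) → ∀ r R : ℕ, 1 ≤ r → r ≤ R →
      R < zdCharLength ε p →
        (bondPercolation (zdGraph 2) p).real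
            {ω | ∃ x ∈ box 2 r, ∃ y ∉ box 2 R, ω ∈ openConnIn Set.univ x y} ≤
          C * ((r : ℝ) / R) ^ α := by
  set c : ℝ := ((ε ^ 6 / 4) ^ (3 * 4)) ^ 4 with hc
  have hc0 : 0 < c := by positivity
  have hc1 : c ≤ 1 := by
    have hq : ε ^ 6 / 4 ≤ 1 := by
      have : ε ^ 6 ≤ 1 := pow_le_one₀ hε.le (by linarith)
      linarith
    have hq0 : 0 ≤ ε ^ 6 / 4 := by positivity
    exact pow_le_one₀ (by positivity) (pow_le_one₀ hq0 hq)
  have hlog4 : 0 < Real.log 4 := Real.log_pos (by norm_num)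
  refine ⟨(12 : ℝ) ^ (c / Real.log 4), c / Real.log 4, by positivity, div_pos hc0 hlog4,
    fun p hp r R hr hrR hRL => ?_⟩
  by_cases h3 : 3 * r ≤ R + 1
  · obtain ⟨K, hK, hpow⟩ := ZdOneArm.pow_le_rpow_of_scales hc0 hc1 hr hrR h3
    refine (real_boxToFar_le_pow_of_half_lt hε hε' hp hr ?_ hK).trans hpow
    omega
  · push Not at h3
    exact measureReal_le_one.trans (ZdOneArm.one_le_rpow_of_close (div_pos hc0 hlog4).le hr hrR h3)

end Literature.Probability.Percolation
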